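import Mathlib

/-!
# The family wall `Σ_i |X_i||Y_i| ≤ dim J` — explicit / elementary proof (siege k6)

Route `LevelGradedCohnUmans`, crux `GradedDesignFamily` (stmt-MatrixMultiplication-7610), registered
stub `familyWall_card_le_finrank` (line `Sketch`, the card's "second lemma" with every `Z_i` non-empty).
This file is an INDEPENDENT proof (siege variation "explicit / elementary"), kept in its own namespace
`…Theorems.GradedDesignFamily.FamilyWallK6`; it does not use dual spaces.

The argument exhibits `Σ_i |X_i||Y_i|` EXPLICIT vectors of `J` and reads off linear independence by a
single point evaluation:

* fix `z_i ∈ Z_i` and, for `x ∈ X_i`, the separator `f_{i,x} ∈ J` of the target `(x, z_i)` given by the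
  simultaneous-separation hypothesis;
* for `x ∈ X_i`, `y ∈ Y_i` put `φ_{i,x,y}(g) := f_{i,x}(g · y⁻¹ z_i)`, a RIGHT translate of `f_{i,x}`,
  hence a member of `J` (`J` is right-translation invariant);
* evaluated at a point `x₀⁻¹ y₀` with `x₀ ∈ X_j`, `y₀ ∈ Y_j`, the vector `φ_{i,x,y}` takes the value
  `f_{i,x}(x₀⁻¹ y₀ y⁻¹ z_i)`, a mixed quadruple product of the family, which by separation is `1` when
  `(j, x₀, y₀) = (i, x, y)` and `0` otherwise.

So a vanishing combination `Σ c_{i,x,y} φ_{i,x,y} = 0`, evaluated at `x₀⁻¹ y₀`, gives `c_{j,x₀,y₀} = 0`: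
the `φ`'s are linearly independent members of `J`, and their number `Σ_i |X_i||Y_i|` is at most
`dim J` (`familyWall_card_le_finrank`). [cite: CohnKleinbergSzegedyUmans2005, Def. 5.1]
-/

noncomputable section

set_option linter.dupNamespace false

open scoped BigOperators
open Module

namespace Summit.MatrixMultiplication.MatrixMultiplication.Theorems.GradedDesignFamily.FamilyWallK6

/-- **The family wall** (explicit form).  If `J ≤ ℂ^G` is right-translation invariant and the family
`(X_i, Y_i, Z_i)_{i : ι}` with all `Z_i` non-empty is simultaneously `J`-separated, then
`Σ_i |X_i|·|Y_i| ≤ dim J`: the right translates `g ↦ f_{i,x}(g · y⁻¹ z_i)` (`x ∈ X_i`, `y ∈ Y_i`) of the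
separators are linearly independent in `J`, as evaluation at the points `x₀⁻¹ y₀` shows.
[cite: CohnKleinbergSzegedyUmans2005, Def. 5.1] -/
theorem familyWall_card_le_finrank {G : Type} [Group G] [Fintype G] {ι : Type} [Fintype ι]
    [DecidableEq ι] (J : Submodule ℂ (G → ℂ)) (hJ : ∀ f ∈ J, ∀ u : G, (fun g : G => f (g * u)) ∈ J)
    (X Y Z : ι → Finset G) (hZ : ∀ i, (Z i).Nonempty)
    (hsep : ∀ i : ι, ∀ x₀ ∈ X i, ∀ z₀ ∈ Z i, ∃ f ∈ J, ∀ a b : ι, ∀ x ∈ X a, ∀ y ∈ Y a, ∀ y' ∈ Y b,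
      ∀ z ∈ Z b, ((a = i ∧ b = i ∧ x = x₀ ∧ y = y' ∧ z = z₀) → f (x⁻¹ * y * y'⁻¹ * z) = 1) ∧
        (¬ (a = i ∧ b = i ∧ x = x₀ ∧ y = y' ∧ z = z₀) → f (x⁻¹ * y * y'⁻¹ * z) = 0)) :
    ∑ i, (X i).card * (Y i).card ≤ finrank ℂ J := by
  classical
  -- a base point `zc i ∈ Z i` in every block
  choose zc hzc using hZ
  -- the separators `f i x _ : G → ℂ` of the targets `(x, zc i)`, members of `J`
  choose f hfJ hf using fun i x (hx : x ∈ X i) => hsep i x hx (zc i) (hzc i)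
  -- index type: triples `(i, x, y)` with `x ∈ X i`, `y ∈ Y i`
  let S : Type := Σ i : ι, ↥(X i) × ↥(Y i)
  -- the explicit vectors: right translates of the separators
  let φ : S → G → ℂ := fun s g => f s.1 s.2.1 s.2.1.2 (g * ((s.2.2 : G)⁻¹ * zc s.1))
  have hφJ : ∀ s, φ s ∈ J := fun s => hJ _ (hfJ s.1 s.2.1 s.2.1.2) _
  -- their values at the test points `x₀⁻¹ y₀`
  have hval : ∀ (s : S) (j : ι) (x₀ : G) (_ : x₀ ∈ X j) (y₀ : G) (_ : y₀ ∈ Y j),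
      φ s (x₀⁻¹ * y₀) = if j = s.1 ∧ x₀ = s.2.1 ∧ y₀ = s.2.2 then 1 else 0 := by
    rintro ⟨i, ⟨x, hx⟩, ⟨y, hy⟩⟩ j x₀ hx₀ y₀ hy₀
    obtain ⟨h1, h0⟩ := hf i x hx j i x₀ hx₀ y₀ hy₀ y hy (zc i) (hzc i)
    have hassoc : x₀⁻¹ * y₀ * (y⁻¹ * zc i) = x₀⁻¹ * y₀ * y⁻¹ * zc i := (mul_assoc _ _ _).symm
    simp only [φ, hassoc]
    split_ifs with hc
    · exact h1 ⟨hc.1, rfl, hc.2.1, hc.2.2, rfl⟩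
    · exact h0 fun h => hc ⟨h.1, h.2.2.1, h.2.2.2.1⟩
  -- linear independence in `ℂ^G`, read off by point evaluation
  have hli : LinearIndependent ℂ φ := by
    rw [Fintype.linearIndependent_iff]
    intro c hc s₀
    obtain ⟨j, ⟨x₀, hx₀⟩, ⟨y₀, hy₀⟩⟩ := s₀
    have key := congrFun hc (x₀⁻¹ * y₀)
    rw [Finset.sum_apply, Pi.zero_apply,
      Finset.sum_eq_single (⟨j, ⟨x₀, hx₀⟩, ⟨y₀, hy₀⟩⟩ : S)] at key
    · simpa [Pi.smul_apply, smul_eq_mul, hval _ j x₀ hx₀ y₀ hy₀] using key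
    · rintro ⟨i, ⟨x, hx⟩, ⟨y, hy⟩⟩ - hne
      rw [Pi.smul_apply, smul_eq_mul, hval _ j x₀ hx₀ y₀ hy₀, if_neg, mul_zero]
      rintro ⟨rfl, h2, h3⟩
      simp only at h2 h3
      subst h2 h3
      exact hne rfl
    · exact fun h => (h (Finset.mem_univ _)).elim
  -- the same vectors as members of `J`
  have hliJ : LinearIndependent ℂ (fun s : S => (⟨φ s, hφJ s⟩ : J)) :=
    LinearIndependent.of_comp J.subtype hli
  have hcard : Fintype.card S = ∑ i, (X i).card * (Y i).card := by
    simp only [S, Fintype.card_sigma, Fintype.card_prod, Fintype.card_coe]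
  calc ∑ i, (X i).card * (Y i).card = Fintype.card S := hcard.symm
    _ ≤ finrank ℂ J := hliJ.fintype_card_le_finrank

end Summit.MatrixMultiplication.MatrixMultiplication.Theorems.GradedDesignFamily.FamilyWallK6

end
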